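import Summits.Ventures.CertifiedManyBodySolver.Downfold.TppSeamOrderFilling
import Summits.Ventures.CertifiedManyBodySolver.Downfold.TppSeamFillingDiagU
import Literature.MathematicalPhysics.QuantumLattice.HubbardTTPrimeTPPDoublingUAnchorsAllFillings
import Literature.MathematicalPhysics.QuantumLattice.DWaveOrderParameterTPrimeCells
import HarnessLib

/-!
# The ORDER word of object M at the box's own filling — `U`-DRESSED `t''` edition (and the kinematic
# `16/π²` constant on the `t'` leg): the ABSENT(`< m₀`) budget of `boxLa214M_M15` drops from `0.734 t` to `0.554 t`

Venture CertifiedManyBodySolver, stage S1 ↔ S2 seam (cell `pub/hubbard-downfold`'s grammar; sequel of mod-1's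
`TppSeamOrderFilling.lean`, p48xxxx); contributed by the S2 seat `hubbard-box-p3` (cell `pub/hubbard-fast`, 2026-08-28).
`holdsOn_pairAmplitude_le_of_anchor_filling` pays, per unit of `m = max |tpp/t|`, the kinematic `16/π²` TWICE (once in
the canonical cap `e^M_n ≤ R + (16/π²)m`, once in the sourced floor `e^M_src ≥ e_src − (16/π²)m`) and `4` per unit of
`t'`-deviation of the sourced anchor. This file replaces

* the `t'` leg `4·eS.dev t'₀` by `(16/π²)·eS.dev t'₀` (`dWaveSourceEnergyDensityTT'_ge_of_ge_tp_kinematic`,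
  `Literature/DWaveOrderParameterTPrimeCells`);
* the cap allowance `(16/π²)·m` by `m·(V·D − ℓ)` — a double-occupancy word `D` on the M cell and a `t' = 0` row
  `ℓ ≤ e(1, 0, V, n)` at the box's fillings (`holdsOn_tpp_cap_of_docc_diagU`, `TppSeamFillingDiagU`);
* the sourced-floor allowance `(16/π²)·m` by `m·|ℓ'|` for an all-fillings row `ℓ' ≤ e(1, 0, V', ρ)` (`0 < ρ < 2`, `ℓ' ≤ 0`),
  the anchor being read at `U₀ ≤ eU.lo − m·V'` (`le_tppSourced_of_sourcedAnchor_diagU_of_abs_le`,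
  `Literature/HubbardTTPrimeTPPDoublingUAnchorsAllFillings`); `V' = 0`, `ℓ' = −16/π²` is the old term.

Results: `holdsOn_pairAmplitude_le_of_anchor_filling_diagU` (the bound), `…_lt_…_near_diagU` (the ABSENT word), and the
`boxLa214M_M15` instance with `V = 4`, `V' = 0`: box cost `(16/π²)(7/100) + (7/50)(4·D − ℓ) + (16/π²)(7/50)`, i.e.
**`≤ 0.554 t`** for a docc word `D ≤ 1/10` and the `(4, ·, 0)` row `ℓ = −1.1233` on `n ∈ [0.855, 0.895]` (registry #544 at
`7/8` extrapolated by convexity with the caps #528 (`3/4`) and #20 (`n = 1`); a HYPOTHESIS here) — against `0.734 t`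
(`la214M_M15_orderSeam_filling_cost_le`); an all-fillings row `ℓ'` at `V' > 0` lowers the last term further.

Everything is PROVED; no definition. HONEST FRAMING: variational, ceiling/ABSENT side only; `e_P(σ)` of
translation-invariant near-minimisers is the surrogate of the (undefined in the tree) torus-limit order parameter of object M;
the docc word, the `t' = 0` rows and the sourced floor are HYPOTHESES to be discharged by their producers; nothing here floors
order or bears on `T_c`; no number about any material is certified by this file.
-/

noncomputable section

namespace Summit.Ventures.CertifiedManyBodySolver.Downfold

open NonemptyInterval Literature.MathematicalPhysics.QuantumLattice
  Literature.MathematicalPhysics.QuantumLattice.ThermodynamicLimit Literature.Probability.LatticeModels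
open Matrix HubbardWave0 _root_.Filter
open scoped _root_.Topology

/-- **THE ORDER WORD AT THE BOX'S OWN FILLING, `U`-DRESSED.** Let `B` carry entries `eU, eS, eSS, eN` (`U/t`, `tp/t`,
`tpp/t`, `n`) with `eU.lo ≥ 0`, `0 < eN.lo`, `eN.hi < 2`, `m = max |eSS.lo| |eSS.hi|`. Inputs: the M cell's S2 CAP `R`; a
double-occupancy word `D` on the M cell (every torus-limit ground state); a `t' = 0` row `ℓ ≤ e(1,0,V,n)` at the box's fillings
with `V ≥ 0`, `0 ≤ V·D − ℓ`; ONE sourced floor `lo ≤ e_src(t'₀, U₀, μ₀, h)`, `h > 0`; an all-fillings row `ℓ' ≤ 0`,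
`ℓ' ≤ e(1,0,V',ρ)` (`0 < ρ < 2`), `V' ≥ 0`. Then on `B`: for every `ε` and every translation-invariant `σ` with
`σ.density = p n` whose source-free object-M mean energy is within `ε` of the canonical minimum,
`e_P(σ) ≤ (R + m·(V·D − ℓ) − μ₀·(p n) − lo + (16/π²)·eS.dev t'₀ + max 0 (U₀ − (eU.lo − m·V')) − m·ℓ' + ε)/h`.
[cite: KomaTasaki1994, §1] -/
theorem holdsOn_pairAmplitude_le_of_anchor_filling_diagU {B : OneBandBox} {eU eS eSS eN : Entry}
    (hU : B .UOverT = some eU) (hS : B .tpOverT = some eS) (hSS : B .tppOverT = some eSS)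
    (hN : B .filling = some eN) (hU0 : 0 ≤ eU.encl.fst) (hN0 : 0 < eN.encl.fst) (hN2 : eN.encl.snd < 2)
    {R : ℝ} (hR : ∀ θ ∈ Set.Icc (s2Lo eU eS eN) (s2Hi eU eS eN), energyDensityTT' 1 (θ 1) (θ 0) (θ 2) ≤ R)
    {D : ℝ}
    (hD : ∀ θ ∈ Set.Icc (s2Lo eU eS eN) (s2Hi eU eS eN),
      ∀ (ω : InfVolFermionState 2) (Ls : ℕ → ℕ) (ψ : ∀ L, Fock (Orb (FermionTorus 2 L))),
      Tendsto Ls atTop atTop →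
      (∀ j, IsGroundStateInSector (hubbardTorusTT' (Ls j) 1 (θ 1) (θ 0)) (rectN (θ 2) (Ls j)) 0 (ψ (Ls j))) →
      (∀ j, star (ψ (Ls j)) ⬝ᵥ ψ (Ls j) = 1) → ω.IsTorusLimitOf ψ Ls →
      ω.meanEnergy (hubbardTTPrimeFermionInteraction 0 0 1) 1 ≤ D)
    {V ℓ : ℝ} (hV : 0 ≤ V) (hℓ : ∀ n : ℝ, eN.Mem n → ℓ ≤ energyDensityTT' 1 0 V n) (hDℓ : 0 ≤ V * D - ℓ)
    {t'₀ U₀ μ₀ h lo : ℝ} (hh : 0 < h) (hlo : lo ≤ dWaveSourceEnergyDensityTT' t'₀ U₀ μ₀ h)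
    {V' ℓ' : ℝ} (hV' : 0 ≤ V') (hℓ'0 : ℓ' ≤ 0) (hℓ' : ∀ ρ : ℝ, 0 < ρ → ρ < 2 → ℓ' ≤ energyDensityTT' 1 0 V' ρ) :
    HoldsOn (fun p : OneBandCoord → ℝ => ∀ (ε : ℝ) (σ : InfVolFermionState 2), σ.IsTranslationInvariant →
      σ.density = p .filling →
      σ.meanEnergy (hubbardTT'T''FermionInteraction 1 (p .tpOverT) (p .tppOverT) (p .UOverT)) 2 ≤
        (hubbardTT'T''FermionInteraction 1 (p .tpOverT) (p .tppOverT) (p .UOverT)).tiGroundEnergyDensityAt 2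
          (p .filling) + ε →
      σ.meanEnergy (pairSourceInteraction dWaveFormFactor) 1 ≤
        (R + ((max |eSS.encl.fst| |eSS.encl.snd| : ℚ) : ℝ) * (V * D - ℓ) - μ₀ * p .filling - lo +
          16 / Real.pi ^ 2 * eS.dev t'₀ +
          max 0 (U₀ - (((eU.encl.fst : ℚ) : ℝ) - ((max |eSS.encl.fst| |eSS.encl.snd| : ℚ) : ℝ) * V')) -
          ((max |eSS.encl.fst| |eSS.encl.snd| : ℚ) : ℝ) * ℓ' + ε) / h) B := by
  intro p hp ε σ hσ hρ hε
  -- (1) the canonical cap on the box, dressed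
  have hcap := holdsOn_tpp_cap_of_docc_diagU hU hS hSS hN hU0 hN0 hN2 hR hD hV hℓ hDℓ p hp
  -- (2) the sourced grand-canonical principle at (p, μ₀, h) for the state σ
  have hvar := (hubbardTT'T''SourcedInteraction 1 (p .tpOverT) (p .tppOverT) (p .UOverT) μ₀
    dWaveFormFactor h).tiGroundEnergyDensity_le_meanEnergy 2 hσ
  rw [σ.meanEnergy_hubbardTT'T''Sourced 1 (p .tpOverT) (p .tppOverT) (p .UOverT) μ₀ dWaveFormFactor h,
    hρ] at hvar
  -- (3) the sourced floor: anchor → member's t' (16/π²) → down to U₁ = eU.lo − m V' → dressed t'' step at the member's U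
  have h1 : lo - 16 / Real.pi ^ 2 * |p .tpOverT - t'₀| ≤ dWaveSourceEnergyDensityTT' (p .tpOverT) U₀ μ₀ h :=
    dWaveSourceEnergyDensityTT'_ge_of_ge_tp_kinematic hlo (p .tpOverT)
  set m : ℝ := ((max |eSS.encl.fst| |eSS.encl.snd| : ℚ) : ℝ) with hm
  have hUmem := mem_ratCast_iff.1 (hp _ _ hU)
  have h4 : |p .tppOverT| ≤ m := Entry.abs_le_of_mem (hp _ _ hSS)
  have h2 := dWaveSourceEnergyDensityTT'_ge_of_ge_U_lowerEdge h1
    (le_refl (((eU.encl.fst : ℚ) : ℝ) - m * V'))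
  have h3 := le_tppSourced_of_sourcedAnchor_diagU_of_abs_le (p .tpOverT) (U := p .UOverT) h4 hV'
    (by linarith [hUmem.1]) μ₀ h h2 hℓ'0 hℓ'
  have h5 : |p .tpOverT - t'₀| ≤ eS.dev t'₀ := Entry.abs_sub_le_dev_of_mem (hp _ _ hS) t'₀
  have hπ : 0 ≤ 16 / Real.pi ^ 2 := by positivity
  rw [le_div_iff₀ hh]
  nlinarith [mul_le_mul_of_nonneg_left h5 hπ]

/-- **THE ABSENT(`< m₀`) WORD, `U`-DRESSED.** Same data and a threshold `m₀` with
`R + m·(V·D − ℓ) − lo + (16/π²)·eS.dev t'₀ + max 0 (U₀ − (eU.lo − m·V')) − m·ℓ' − min (μ₀·eN.lo) (μ₀·eN.hi) < h·m₀`. Then on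
`B`: NO translation-invariant canonical minimiser of object M at any member's couplings and filling has `d`-wave pair
amplitude `≥ m₀`. [cite: KomaTasaki1994, §1] -/
theorem holdsOn_pairAmplitude_lt_of_anchor_filling_near_diagU {B : OneBandBox} {eU eS eSS eN : Entry}
    (hU : B .UOverT = some eU) (hS : B .tpOverT = some eS) (hSS : B .tppOverT = some eSS)
    (hN : B .filling = some eN) (hU0 : 0 ≤ eU.encl.fst) (hN0 : 0 < eN.encl.fst) (hN2 : eN.encl.snd < 2)
    {R : ℝ} (hR : ∀ θ ∈ Set.Icc (s2Lo eU eS eN) (s2Hi eU eS eN), energyDensityTT' 1 (θ 1) (θ 0) (θ 2) ≤ R)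
    {D : ℝ}
    (hD : ∀ θ ∈ Set.Icc (s2Lo eU eS eN) (s2Hi eU eS eN),
      ∀ (ω : InfVolFermionState 2) (Ls : ℕ → ℕ) (ψ : ∀ L, Fock (Orb (FermionTorus 2 L))),
      Tendsto Ls atTop atTop →
      (∀ j, IsGroundStateInSector (hubbardTorusTT' (Ls j) 1 (θ 1) (θ 0)) (rectN (θ 2) (Ls j)) 0 (ψ (Ls j))) →
      (∀ j, star (ψ (Ls j)) ⬝ᵥ ψ (Ls j) = 1) → ω.IsTorusLimitOf ψ Ls →
      ω.meanEnergy (hubbardTTPrimeFermionInteraction 0 0 1) 1 ≤ D)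
    {V ℓ : ℝ} (hV : 0 ≤ V) (hℓ : ∀ n : ℝ, eN.Mem n → ℓ ≤ energyDensityTT' 1 0 V n) (hDℓ : 0 ≤ V * D - ℓ)
    {t'₀ U₀ μ₀ h lo m₀ : ℝ} (hh : 0 < h) (hlo : lo ≤ dWaveSourceEnergyDensityTT' t'₀ U₀ μ₀ h)
    {V' ℓ' : ℝ} (hV' : 0 ≤ V') (hℓ'0 : ℓ' ≤ 0) (hℓ' : ∀ ρ : ℝ, 0 < ρ → ρ < 2 → ℓ' ≤ energyDensityTT' 1 0 V' ρ)
    (hnear : R + ((max |eSS.encl.fst| |eSS.encl.snd| : ℚ) : ℝ) * (V * D - ℓ) - lo + 16 / Real.pi ^ 2 * eS.dev t'₀ +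
        max 0 (U₀ - (((eU.encl.fst : ℚ) : ℝ) - ((max |eSS.encl.fst| |eSS.encl.snd| : ℚ) : ℝ) * V')) -
        ((max |eSS.encl.fst| |eSS.encl.snd| : ℚ) : ℝ) * ℓ' -
        min (μ₀ * ((eN.encl.fst : ℚ) : ℝ)) (μ₀ * ((eN.encl.snd : ℚ) : ℝ)) < h * m₀) :
    HoldsOn (fun p : OneBandCoord → ℝ => ∀ σ : InfVolFermionState 2, σ.IsTranslationInvariant →
      σ.density = p .filling →
      σ.meanEnergy (hubbardTT'T''FermionInteraction 1 (p .tpOverT) (p .tppOverT) (p .UOverT)) 2 =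
        (hubbardTT'T''FermionInteraction 1 (p .tpOverT) (p .tppOverT) (p .UOverT)).tiGroundEnergyDensityAt 2
          (p .filling) →
      σ.meanEnergy (pairSourceInteraction dWaveFormFactor) 1 < m₀) B := by
  intro p hp σ hσ hρ hmin
  have hk := holdsOn_pairAmplitude_le_of_anchor_filling_diagU hU hS hSS hN hU0 hN0 hN2 hR hD hV hℓ hDℓ hh hlo
    hV' hℓ'0 hℓ' p hp 0 σ hσ hρ (by rw [add_zero]; exact hmin.le)
  have hn := min_mul_le_mul_of_mem_Icc μ₀ (mem_ratCast_iff.1 (hp _ _ hN))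
  refine hk.trans_lt ?_
  rw [div_lt_iff₀ hh]
  linarith

/-! ### The La-214 M15 object-M box: anchor at `U₀ = eU.lo = 63/10`, `V = 4`, `V' = 0` -/

/-- **La-214 M15, object M, `U`-DRESSED order word** (anchor `(t'₀, U₀) = (−1/10, 63/10)`, `V = 4` on the cap side with
a docc word `D` on the M cell and a `(4, ·, 0)` row `ℓ` at the box's fillings `[171/200, 179/200]`, kinematic sourced side
`V' = 0`): on `boxLa214M_M15`, for every translation-invariant `ε`-near canonical minimiser at the member's couplings and
filling, `e_P(σ) ≤ (R + (7/50)(4D − ℓ) − μ₀·n − lo + (16/π²)(7/100) + (16/π²)(7/50) + ε)/h` — NO `U` cost, NO `μ` interval.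
[cite: KomaTasaki1994, §1] -/
theorem boxLa214M_M15_pairAmplitude_le_anchorLo_filling_diagU {R μ₀ h lo D ℓ : ℝ}
    (hR : ∀ θ ∈ Set.Icc (![63/10, -17/100, 171/200] : Fin 3 → ℝ) ![137/10, -3/100, 179/200],
      energyDensityTT' 1 (θ 1) (θ 0) (θ 2) ≤ R)
    (hD : ∀ θ ∈ Set.Icc (![63/10, -17/100, 171/200] : Fin 3 → ℝ) ![137/10, -3/100, 179/200],
      ∀ (ω : InfVolFermionState 2) (Ls : ℕ → ℕ) (ψ : ∀ L, Fock (Orb (FermionTorus 2 L))),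
      Tendsto Ls atTop atTop →
      (∀ j, IsGroundStateInSector (hubbardTorusTT' (Ls j) 1 (θ 1) (θ 0)) (rectN (θ 2) (Ls j)) 0 (ψ (Ls j))) →
      (∀ j, star (ψ (Ls j)) ⬝ᵥ ψ (Ls j) = 1) → ω.IsTorusLimitOf ψ Ls →
      ω.meanEnergy (hubbardTTPrimeFermionInteraction 0 0 1) 1 ≤ D)
    (hℓ : ∀ n : ℝ, la214_M15_n.Mem n → ℓ ≤ energyDensityTT' 1 0 4 n) (hDℓ : 0 ≤ 4 * D - ℓ)
    (hh : 0 < h) (hlo : lo ≤ dWaveSourceEnergyDensityTT' (-1/10) (63/10) μ₀ h) :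
    HoldsOn (fun p : OneBandCoord → ℝ => ∀ (ε : ℝ) (σ : InfVolFermionState 2), σ.IsTranslationInvariant →
      σ.density = p .filling →
      σ.meanEnergy (hubbardTT'T''FermionInteraction 1 (p .tpOverT) (p .tppOverT) (p .UOverT)) 2 ≤
        (hubbardTT'T''FermionInteraction 1 (p .tpOverT) (p .tppOverT) (p .UOverT)).tiGroundEnergyDensityAt 2
          (p .filling) + ε →
      σ.meanEnergy (pairSourceInteraction dWaveFormFactor) 1 ≤
        (R + (7/50 : ℝ) * (4 * D - ℓ) - μ₀ * p .filling - lo + 16 / Real.pi ^ 2 * (7/100 : ℝ) +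
          16 / Real.pi ^ 2 * (7/50 : ℝ) + ε) / h)
      boxLa214M_M15 := by
  have hfree : ∀ ρ : ℝ, 0 < ρ → ρ < 2 → -(16 / Real.pi ^ 2) ≤ energyDensityTT' 1 0 0 ρ := fun ρ h0 h2 => by
    have h := neg_sixteen_mul_abs_div_pi_sq_le_energyDensityTT' 1 (le_refl (0 : ℝ)) h0.le h2
    rw [abs_one, mul_one, neg_div] at h
    exact h
  have hk := holdsOn_pairAmplitude_le_of_anchor_filling_diagU (B := boxLa214M_M15) (eU := la214M_M15_U)
    (eS := la214M_M15_tp) (eSS := la214M_M15_tpp) (eN := la214_M15_n) rfl rfl rfl rfl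
    (by rw [la214M_M15_U, Entry.encl_ofEnds_fst]; norm_num)
    (by rw [la214_M15_n, Entry.encl_ofEnds_fst]; norm_num)
    (by rw [la214_M15_n, Entry.encl_ofEnds_snd]; norm_num)
    (R := R) (by rw [la214M_M15_s2Lo, la214M_M15_s2Hi]; exact hR)
    (D := D) (by rw [la214M_M15_s2Lo, la214M_M15_s2Hi]; exact hD) (V := 4) (by norm_num) hℓ hDℓ hh hlo
    (V' := 0) le_rfl (neg_nonpos.mpr (by positivity) : -(16 / Real.pi ^ 2) ≤ (0 : ℝ)) hfree
  rw [la214M_M15_tp_dev_mid, la214M_M15_tpp_abs] at hk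
  have hc : (((7/50 : ℚ)) : ℝ) = (7/50 : ℝ) := by norm_num
  have hu : max 0 ((63/10 : ℝ) - ((((la214M_M15_U.encl.fst : ℚ)) : ℝ) - (7/50 : ℝ) * 0)) = 0 := by
    rw [la214M_M15_U, Entry.encl_ofEnds_fst]; norm_num
  rw [hc, hu] at hk
  intro p hp ε σ hσ hρ hε
  exact (hk p hp ε σ hσ hρ hε).trans_eq (by ring)

/-- **The `U`-dressed fixed-filling box cost of `boxLa214M_M15` is at most `0.554 t`** once the M cell carries a docc word
`D ≤ 1/10` and the `(4, ·, 0)` row `ℓ = −11233/10000` (`−1.1233`): `(16/π²)(7/100) + (7/50)(4·(1/10) + 1.1233) + (16/π²)(7/50)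
≤ 0.1135 + 0.2133 + 0.2270` — against `0.734 t` (`la214M_M15_orderSeam_filling_cost_le`: `4·(7/100) + (32/π²)(7/50)`).
[folklore] -/
theorem la214M_M15_orderSeam_filling_cost_diagU_le :
    16 / Real.pi ^ 2 * (7/100 : ℝ) + (7/50 : ℝ) * (4 * (1/10 : ℝ) - (-(11233/10000 : ℝ))) +
      16 / Real.pi ^ 2 * (7/50 : ℝ) ≤ 0.554 := by
  have hπ : (3.141592 : ℝ) < Real.pi := Real.pi_gt_d6
  have hπ2 : (3.141592 : ℝ) ^ 2 < Real.pi ^ 2 := pow_lt_pow_left₀ hπ (by norm_num) (by norm_num)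
  have h16 : 16 / Real.pi ^ 2 < 16 / (3.141592 : ℝ) ^ 2 :=
    div_lt_div_of_pos_left (by norm_num) (by positivity) hπ2
  nlinarith

/-- **Bookkeeping of the three legs** for the annex tables: with `m = 7/50`, `V = 4`, `D = 1/10`, `ℓ = −1.1233`:
`t'` leg `(16/π²)(7/100) ≤ 0.1135` (was `0.28`), cap leg `(7/50)(0.4 + 1.1233) = 0.213262` (was `(16/π²)(7/50) ≤ 0.227`),
sourced leg unchanged `≤ 0.227` at `V' = 0` (an all-fillings row `ℓ'` at `V' > 0` lowers it to `(7/50)|ℓ'|`). [folklore] -/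
theorem la214M_M15_orderSeam_filling_legs_diagU :
    16 / Real.pi ^ 2 * (7/100 : ℝ) ≤ 0.1135 ∧ (7/50 : ℝ) * (4 * (1/10 : ℝ) - (-(11233/10000 : ℝ))) = 0.213262 ∧
      16 / Real.pi ^ 2 * (7/50 : ℝ) ≤ 0.227 := by
  have hπ : (3.141592 : ℝ) < Real.pi := Real.pi_gt_d6
  have hπ2 : (3.141592 : ℝ) ^ 2 < Real.pi ^ 2 := pow_lt_pow_left₀ hπ (by norm_num) (by norm_num)
  have h16 : 16 / Real.pi ^ 2 < 16 / (3.141592 : ℝ) ^ 2 :=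
    div_lt_div_of_pos_left (by norm_num) (by positivity) hπ2
  refine ⟨by nlinarith, by norm_num, by nlinarith⟩

end Summit.Ventures.CertifiedManyBodySolver.Downfold

end
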